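import Summits.HubbardSuperconductivity.HubbardSuperconductivity.Theorems.BalabanIRBirComplexStableXYRSliceDensity
import Summits.HubbardSuperconductivity.HubbardSuperconductivity.Theorems.BalabanIRBirComplexStableXYReality
import HarnessLib

/-!
# Crux `BirComplexStableXYR` (stmt-HubbardSuperconductivity-14845), `r = 2`: Jensen turns slice order into a
# one-sided FREE-ENERGY bound (the "coercivity-budget-jensen-transfer" reduction, provable part)

Support file (prover seat 0, route BalabanIR).  For `r = 2`, class (R) (time-reflection Hermiticity) and even
`M`, the equal-time slice marginal of the complex weight `e^{-A}` is a positive density `ρ` (file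
`…BirComplexStableXYRSliceDensity`).  Rewarding the slice-magnetisation DEFICIT `D = 1 - O(θ(·,0))` by `e^{hD}`,
`h > 0`, and applying Jensen's inequality for `exp` under the probability density `ρ/∫ρ` gives

* `birEven_jensenDeficitBound` — `0 < Re Z`, `Im Z = 0`, `0 < Re Z_h`, `Im Z_h = 0` and
  **`Re(N/Z) ≥ 1 - log(Re Z_h / Re Z)/h`**, where `Z_h = ∫ e^{h(1 - O(θ(·,0)))} e^{-A}` and `N/Z` is the
  crux's slice order (all `let`s of the crux verbatim, `r = 2`);
* `birComplexStableXYR_r2_of_freeEnergyBound` — consequently the `r = 2` instance of the restated engine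
  follows from ONE one-sided free-energy stability inequality `Re Z_{ηK} ≤ e^{C} Re Z` (uniform in `K ≥ K₀`,
  admissible `c`, even `L₀ ≤ L ≤ M`): slice order `≥ 1 - C/(ηK) ≥ 1/2` for `K ≥ 2C/η`.

The free-energy inequality itself (with `η = 16 c₀`, a quarter of the slice's own coercive budget, so that the
rewarded action stays in the coercive (R)∧(P) class) is the crux-sized input proposed by idea card
`Cruxes/BirComplexStableXYR/Ideas/coercivity-budget-jensen-transfer.md`; this file proves the transfer only.
Elementary ingredient: the weighted Jensen inequality `exp(∫ f w/∫ w) ≤ ∫ e^f w/∫ w` for `w ≥ 0`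
(`jensen_exp_weighted`, tangent-line proof). [folklore]
-/

noncomputable section

namespace Summit.HubbardSuperconductivity.HubbardSuperconductivity.Theorems

open scoped BigOperators ComplexConjugate
open MeasureTheory Literature.Probability.LatticeModels

/-- **Weighted Jensen inequality for `exp`.** For a weight `w ≥ 0` of positive total mass and a real `f` (all
integrable as stated): `exp(∫ f w / ∫ w) ≤ (∫ e^{f} w) / ∫ w` — from the tangent line `1 + x ≤ eˣ` at the
weighted mean. [folklore] -/
theorem jensen_exp_weighted {α : Type*} [MeasurableSpace α] (μ : Measure α) (w f : α → ℝ)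
    (hw : ∀ a, 0 ≤ w a) (hwi : Integrable w μ) (hfw : Integrable (fun a => f a * w a) μ)
    (hefw : Integrable (fun a => Real.exp (f a) * w a) μ) (hpos : 0 < ∫ a, w a ∂μ) :
    Real.exp ((∫ a, f a * w a ∂μ) / ∫ a, w a ∂μ) ≤ (∫ a, Real.exp (f a) * w a ∂μ) / ∫ a, w a ∂μ := by
  set m : ℝ := (∫ a, f a * w a ∂μ) / ∫ a, w a ∂μ with hm
  rw [le_div_iff₀ hpos]
  have hpt : ∀ a, Real.exp m * ((f a - m + 1) * w a) ≤ Real.exp (f a) * w a := by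
    intro a
    have h1 : f a - m + 1 ≤ Real.exp (f a - m) := Real.add_one_le_exp _
    have h2 : Real.exp m * Real.exp (f a - m) = Real.exp (f a) := by
      rw [← Real.exp_add]; ring_nf
    calc Real.exp m * ((f a - m + 1) * w a) = (Real.exp m * (f a - m + 1)) * w a := by ring
      _ ≤ (Real.exp m * Real.exp (f a - m)) * w a :=
          mul_le_mul_of_nonneg_right (mul_le_mul_of_nonneg_left h1 (Real.exp_pos m).le) (hw a)
      _ = Real.exp (f a) * w a := by rw [h2]
  have hsplit : (fun a => Real.exp m * ((f a - m + 1) * w a)) =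
      fun a => Real.exp m * (f a * w a) + Real.exp m * (1 - m) * w a := by
    funext a; ring
  have hlin : Integrable (fun a => Real.exp m * ((f a - m + 1) * w a)) μ := by
    rw [hsplit]
    exact (hfw.const_mul _).add (hwi.const_mul _)
  have hI := integral_mono hlin hefw hpt
  have hval : ∫ a, Real.exp m * ((f a - m + 1) * w a) ∂μ = Real.exp m * ∫ a, w a ∂μ := by
    rw [hsplit, integral_add (hfw.const_mul _) (hwi.const_mul _), integral_const_mul, integral_const_mul]
    have hmZ : ∫ a, f a * w a ∂μ = m * ∫ a, w a ∂μ := by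
      rw [hm, div_mul_cancel₀ _ hpos.ne']
    rw [hmZ]; ring
  linarith [hI, hval]

/-- **Jensen deficit bound (`r = 2`, class (R), even `M`).** For the engine's objects with `r = 2`, a table whose
generating function satisfies the functional form of (R), every real `K`, every `h > 0`, `L ≥ 1`, even `M ≥ 1`:
`Z` and the deficit-rewarded partition function `Z_h = ∫ e^{h(1 - O(θ(·,0)))} e^{-A}` are positive reals and the
slice order obeys `Re(N/Z) ≥ 1 - log(Re Z_h / Re Z)/h` (Jensen under the positive slice density of
`birEven_sliceDensity`).  The crux's `let`s verbatim. [folklore] -/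
theorem birEven_jensenDeficitBound (c : ((Fin 2 × Fin 2 × Fin 2) → ℤ) →₀ ℂ) (K h : ℝ) (hh : 0 < h)
    (L M : ℕ) [NeZero L] [NeZero M]
    (hR : ∀ φ : (Fin 2 × Fin 2 × Fin 2) → ℝ,
      c.sum (fun n a => a * Complex.exp (Complex.I *
        ((∑ w, (n w : ℝ) * φ (w.1, w.2.1, Fin.rev w.2.2) : ℝ) : ℂ))) =
      conj (c.sum (fun n a => a * Complex.exp (Complex.I * ((∑ w, (n w : ℝ) * φ w : ℝ) : ℂ)))))
    (hM : Even M) :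
    let sh : (TorusSite 2 L × ZMod M) → (Fin 2 × Fin 2 × Fin 2) → (TorusSite 2 L × ZMod M) :=
      fun s w => (s.1 + ![((w.1 : ℕ) : ZMod L), ((w.2.1 : ℕ) : ZMod L)], s.2 + ((w.2.2 : ℕ) : ZMod M))
    let F : ((Fin 2 × Fin 2 × Fin 2) → ℝ) → ℂ := fun φ =>
      c.sum (fun n a => a * Complex.exp (Complex.I * ((∑ w, (n w : ℝ) * φ w : ℝ) : ℂ)))
    let A : ((TorusSite 2 L × ZMod M) → ℝ) → ℂ := fun θ => (K : ℂ) * ∑ s, F (fun w => θ (sh s w))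
    let cube : Set ((TorusSite 2 L × ZMod M) → ℝ) := Set.pi Set.univ (fun _ => Set.Icc (0:ℝ) (2 * Real.pi))
    let Z : ℂ := MeasureTheory.integral (MeasureTheory.volume.restrict cube) (fun θ => Complex.exp (-(A θ)))
    let O : ((TorusSite 2 L × ZMod M) → ℝ) → ℝ := fun θ =>
      ‖∑ x : TorusSite 2 L, Complex.exp (Complex.I * (θ (x, 0) : ℂ))‖ ^ 2 / (L : ℝ) ^ 4
    let N : ℂ := MeasureTheory.integral (MeasureTheory.volume.restrict cube)
      (fun θ => (O θ : ℂ) * Complex.exp (-(A θ)))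
    let Zh : ℂ := MeasureTheory.integral (MeasureTheory.volume.restrict cube)
      (fun θ => ((Real.exp (h * (1 - O θ)) : ℝ) : ℂ) * Complex.exp (-(A θ)))
    0 < Z.re ∧ Z.im = 0 ∧ 0 < Zh.re ∧ Zh.im = 0 ∧ 1 - Real.log (Zh.re / Z.re) / h ≤ (N / Z).re := by
  dsimp only
  obtain ⟨ρ, hρc, hρ0, -, hρint, hρ⟩ := birEven_sliceDensity c K L M hR hM
  -- the slice cube, slice observable and its bounds
  set CX : Set (TorusSite 2 L → ℝ) :=
    Set.pi Set.univ (fun _ : TorusSite 2 L => Set.Icc (0:ℝ) (2 * Real.pi)) with hCX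
  have hCXc : IsCompact CX := isCompact_univ_pi fun _ => isCompact_Icc
  haveI : IsFiniteMeasure ((volume : Measure (TorusSite 2 L → ℝ)).restrict CX) :=
    isFiniteMeasure_restrict.mpr hCXc.measure_lt_top.ne
  obtain ⟨hOc, hOb⟩ := birSliceObservable_continuous_bound L
  set Oa : (TorusSite 2 L → ℝ) → ℝ := fun a =>
    ‖∑ x : TorusSite 2 L, Complex.exp (Complex.I * (a x : ℂ))‖ ^ 2 / (L : ℝ) ^ 4 with hOa
  have hOc' : Continuous Oa := hOc
  have hEc : Continuous fun a => Real.exp (h * (1 - Oa a)) :=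
    Real.continuous_exp.comp (continuous_const.mul (continuous_const.sub hOc'))
  have hE1 : ∀ a, 1 ≤ Real.exp (h * (1 - Oa a)) := fun a =>
    Real.one_le_exp (mul_nonneg hh.le (sub_nonneg.2 (hOb a).2))
  have hEh : ∀ a, Real.exp (h * (1 - Oa a)) ≤ Real.exp h := fun a =>
    Real.exp_le_exp.2 (by nlinarith [(hOb a).1, hh])
  -- the three density representations
  have hZ := hρ (fun _ => (1 : ℂ)) continuous_const ⟨1, fun _ => by simp⟩
  have hN := hρ (fun a => ((Oa a : ℝ) : ℂ)) (Complex.continuous_ofReal.comp hOc')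
    ⟨1, fun a => by
      rw [Complex.norm_real, Real.norm_of_nonneg (hOb a).1]
      exact (hOb a).2⟩
  have hZh := hρ (fun a => ((Real.exp (h * (1 - Oa a)) : ℝ) : ℂ)) (Complex.continuous_ofReal.comp hEc)
    ⟨Real.exp h, fun a => by
      rw [Complex.norm_real, Real.norm_of_nonneg (Real.exp_pos _).le]
      exact hEh a⟩
  dsimp only at hZ hN hZh
  simp only [one_mul] at hZ
  rw [integral_complex_ofReal] at hZ
  have hN' : (∫ a in CX, ((‖∑ x : TorusSite 2 L, Complex.exp (Complex.I * (a x : ℂ))‖ ^ 2 / (L : ℝ) ^ 4 : ℝ) : ℂ) *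
      ((ρ a : ℝ) : ℂ)) = ((∫ a in CX, Oa a * ρ a : ℝ) : ℂ) := by
    rw [← integral_complex_ofReal]
    refine integral_congr_ae (Filter.Eventually.of_forall fun a => ?_)
    show _ = (((‖∑ x : TorusSite 2 L, Complex.exp (Complex.I * (a x : ℂ))‖ ^ 2 / (L : ℝ) ^ 4 * ρ a : ℝ)) : ℂ)
    push_cast
    ring
  have hZh' : (∫ a in CX, ((Real.exp (h * (1 - ‖∑ x : TorusSite 2 L, Complex.exp (Complex.I * (a x : ℂ))‖ ^ 2 /
      (L : ℝ) ^ 4)) : ℝ) : ℂ) * ((ρ a : ℝ) : ℂ)) = ((∫ a in CX, Real.exp (h * (1 - Oa a)) * ρ a : ℝ) : ℂ) := by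
    rw [← integral_complex_ofReal]
    refine integral_congr_ae (Filter.Eventually.of_forall fun a => ?_)
    show _ = (((Real.exp (h * (1 - ‖∑ x : TorusSite 2 L, Complex.exp (Complex.I * (a x : ℂ))‖ ^ 2 /
      (L : ℝ) ^ 4)) * ρ a : ℝ)) : ℂ)
    push_cast
    ring
  rw [hN'] at hN
  rw [hZh'] at hZh
  rw [hZ, hN, hZh]
  -- integrability on the finite slice-cube measure
  have hρi : Integrable ρ (volume.restrict CX) := hρc.continuousOn.integrableOn_compact hCXc
  have hOρi : Integrable (fun a => Oa a * ρ a) (volume.restrict CX) :=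
    (hOc'.mul hρc).continuousOn.integrableOn_compact hCXc
  have hfρi : Integrable (fun a => h * (1 - Oa a) * ρ a) (volume.restrict CX) :=
    ((continuous_const.mul (continuous_const.sub hOc')).mul hρc).continuousOn.integrableOn_compact hCXc
  have hEρi : Integrable (fun a => Real.exp (h * (1 - Oa a)) * ρ a) (volume.restrict CX) :=
    (hEc.mul hρc).continuousOn.integrableOn_compact hCXc
  -- positivity of `Z_h`
  have hZhpos : 0 < ∫ a in CX, Real.exp (h * (1 - Oa a)) * ρ a := by
    refine lt_of_lt_of_le hρint (integral_mono hρi hEρi fun a => ?_)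
    have := mul_le_mul_of_nonneg_right (hE1 a) (hρ0 a)
    simpa using this
  refine ⟨by simpa using hρint, by simp, by simpa using hZhpos, by simp, ?_⟩
  -- Jensen
  rw [← Complex.ofReal_div, Complex.ofReal_re]
  have hJ := jensen_exp_weighted (volume.restrict CX) ρ (fun a => h * (1 - Oa a)) hρ0 hρi hfρi hEρi hρint
  have hmean : (∫ a in CX, h * (1 - Oa a) * ρ a) / (∫ a in CX, ρ a) =
      h * (1 - (∫ a in CX, Oa a * ρ a) / ∫ a in CX, ρ a) := by
    have : (fun a => h * (1 - Oa a) * ρ a) = fun a => h * ρ a - h * (Oa a * ρ a) := by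
      funext a; ring
    rw [this, integral_sub (hρi.const_mul h) (hOρi.const_mul h), integral_const_mul, integral_const_mul]
    field_simp
  rw [hmean] at hJ
  have hlog : h * (1 - (∫ a in CX, Oa a * ρ a) / ∫ a in CX, ρ a) ≤
      Real.log ((∫ a in CX, Real.exp (h * (1 - Oa a)) * ρ a) / ∫ a in CX, ρ a) := by
    rw [Real.le_log_iff_exp_le (div_pos hZhpos hρint)]
    exact hJ
  have hdiv : (h * (1 - (∫ a in CX, Oa a * ρ a) / ∫ a in CX, ρ a)) / h ≤
      Real.log ((∫ a in CX, Real.exp (h * (1 - Oa a)) * ρ a) / ∫ a in CX, ρ a) / h :=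
    div_le_div_of_nonneg_right hlog hh.le
  rw [mul_div_cancel_left₀ _ hh.ne'] at hdiv
  show 1 - Real.log ((∫ a in CX, Real.exp (h * (1 - Oa a)) * ρ a) / ∫ a in CX, ρ a) / h ≤
      (∫ a in CX, Oa a * ρ a) / ∫ a in CX, ρ a
  linarith

/-- **The `r = 2` engine follows from ONE free-energy stability bound.**  Suppose that for some `η > 0`, `C`,
`K₀`, `L₀`: for all `K ≥ K₀`, every table of the restated class at `r = 2` ((U1),(N),(A),(C),(R),(P)) and all even
`L₀ ≤ L ≤ M`, the deficit-rewarded partition function obeys `Re Z_{ηK} ≤ e^{C} Re Z`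
(`Z_{h} = ∫ e^{h(1 - O(θ(·,0)))} e^{-A}`).  Then the conclusion of `BirComplexStableXYR` holds at `r = 2`:
there are `K₁, L₁` with `Z ≠ 0 ∧ Re(N/Z) ≥ 1/2` for all `K ≥ K₁`, all such tables and all even `L₁ ≤ L ≤ M`
(`K₁ = max(K₀, 2C/η, 1)`, `L₁ = L₀`; slice order `≥ 1 - C/(ηK)` by `birEven_jensenDeficitBound`).  The crux's
`let`s verbatim with `r = 2`. [folklore] -/
theorem birComplexStableXYR_r2_of_freeEnergyBound (B c₀ η C K₀ : ℝ) (L₀ : ℕ) (hη : 0 < η)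
    (hFE : ∀ K : ℝ, K₀ ≤ K → ∀ c : ((Fin 2 × Fin 2 × Fin 2) → ℤ) →₀ ℂ,
      (∀ n ∈ c.support, ∑ w, n w = 0) → c.sum (fun _ a => a) = 0 →
      c.sum (fun n a => ‖a‖ * Real.exp (∑ w, |(n w : ℝ)|)) ≤ B →
      (∀ φ : (Fin 2 × Fin 2 × Fin 2) → ℝ, c₀ * ∑ w, ∑ w', (1 - Real.cos (φ w - φ w')) ≤
        ((fun (φ : (Fin 2 × Fin 2 × Fin 2) → ℝ) => c.sum (fun n a => a * Complex.exp (Complex.I *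
          ((∑ w, (n w : ℝ) * φ w : ℝ) : ℂ)))) φ).re) →
      (∀ n : (Fin 2 × Fin 2 × Fin 2) → ℤ, c (fun w => n (w.1, w.2.1, Fin.rev w.2.2)) = (starRingEnd ℂ) (c (-n))) →
      (∀ n : (Fin 2 × Fin 2 × Fin 2) → ℤ, c (fun w => n (Fin.rev w.1, Fin.rev w.2.1, w.2.2)) = c n) →
      ∀ (L M : ℕ) [NeZero L] [NeZero M], L₀ ≤ L → L ≤ M → Even L → Even M →
      let sh : (TorusSite 2 L × ZMod M) → (Fin 2 × Fin 2 × Fin 2) → (TorusSite 2 L × ZMod M) :=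
        fun s w => (s.1 + ![((w.1 : ℕ) : ZMod L), ((w.2.1 : ℕ) : ZMod L)], s.2 + ((w.2.2 : ℕ) : ZMod M))
      let F : ((Fin 2 × Fin 2 × Fin 2) → ℝ) → ℂ := fun (φ : (Fin 2 × Fin 2 × Fin 2) → ℝ) =>
        c.sum (fun n a => a * Complex.exp (Complex.I * ((∑ w, (n w : ℝ) * φ w : ℝ) : ℂ)))
      let A : ((TorusSite 2 L × ZMod M) → ℝ) → ℂ := fun θ => (K : ℂ) * ∑ s, F (fun w => θ (sh s w))
      let cube : Set ((TorusSite 2 L × ZMod M) → ℝ) :=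
        Set.pi Set.univ (fun _ => Set.Icc (0:ℝ) (2 * Real.pi))
      let Z : ℂ := MeasureTheory.integral (MeasureTheory.volume.restrict cube)
        (fun θ => Complex.exp (-(A θ)))
      let O : ((TorusSite 2 L × ZMod M) → ℝ) → ℝ := fun θ =>
        ‖∑ x : TorusSite 2 L, Complex.exp (Complex.I * (θ (x, 0) : ℂ))‖ ^ 2 / (L : ℝ) ^ 4
      let Zh : ℂ := MeasureTheory.integral (MeasureTheory.volume.restrict cube)
        (fun θ => ((Real.exp (η * K * (1 - O θ)) : ℝ) : ℂ) * Complex.exp (-(A θ)))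
      Zh.re ≤ Real.exp C * Z.re) :
    ∃ K₁ : ℝ, ∃ L₁ : ℕ, ∀ K : ℝ, K₁ ≤ K → ∀ c : ((Fin 2 × Fin 2 × Fin 2) → ℤ) →₀ ℂ,
      (∀ n ∈ c.support, ∑ w, n w = 0) → c.sum (fun _ a => a) = 0 →
      c.sum (fun n a => ‖a‖ * Real.exp (∑ w, |(n w : ℝ)|)) ≤ B →
      (∀ φ : (Fin 2 × Fin 2 × Fin 2) → ℝ, c₀ * ∑ w, ∑ w', (1 - Real.cos (φ w - φ w')) ≤
        ((fun (φ : (Fin 2 × Fin 2 × Fin 2) → ℝ) => c.sum (fun n a => a * Complex.exp (Complex.I *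
          ((∑ w, (n w : ℝ) * φ w : ℝ) : ℂ)))) φ).re) →
      (∀ n : (Fin 2 × Fin 2 × Fin 2) → ℤ, c (fun w => n (w.1, w.2.1, Fin.rev w.2.2)) = (starRingEnd ℂ) (c (-n))) →
      (∀ n : (Fin 2 × Fin 2 × Fin 2) → ℤ, c (fun w => n (Fin.rev w.1, Fin.rev w.2.1, w.2.2)) = c n) →
      ∀ (L M : ℕ) [NeZero L] [NeZero M], L₁ ≤ L → L ≤ M → Even L → Even M →
      let sh : (TorusSite 2 L × ZMod M) → (Fin 2 × Fin 2 × Fin 2) → (TorusSite 2 L × ZMod M) :=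
        fun s w => (s.1 + ![((w.1 : ℕ) : ZMod L), ((w.2.1 : ℕ) : ZMod L)], s.2 + ((w.2.2 : ℕ) : ZMod M))
      let F : ((Fin 2 × Fin 2 × Fin 2) → ℝ) → ℂ := fun (φ : (Fin 2 × Fin 2 × Fin 2) → ℝ) =>
        c.sum (fun n a => a * Complex.exp (Complex.I * ((∑ w, (n w : ℝ) * φ w : ℝ) : ℂ)))
      let A : ((TorusSite 2 L × ZMod M) → ℝ) → ℂ := fun θ => (K : ℂ) * ∑ s, F (fun w => θ (sh s w))
      let cube : Set ((TorusSite 2 L × ZMod M) → ℝ) :=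
        Set.pi Set.univ (fun _ => Set.Icc (0:ℝ) (2 * Real.pi))
      let Z : ℂ := MeasureTheory.integral (MeasureTheory.volume.restrict cube)
        (fun θ => Complex.exp (-(A θ)))
      let O : ((TorusSite 2 L × ZMod M) → ℝ) → ℝ := fun θ =>
        ‖∑ x : TorusSite 2 L, Complex.exp (Complex.I * (θ (x, 0) : ℂ))‖ ^ 2 / (L : ℝ) ^ 4
      Z ≠ 0 ∧ (1/2 : ℝ) ≤ ((MeasureTheory.integral (MeasureTheory.volume.restrict cube)
        (fun θ => (O θ : ℂ) * Complex.exp (-(A θ)))) / Z).re := by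
  refine ⟨max K₀ (max (2 * C / η) 1), L₀, ?_⟩
  intro K hK c hU1 hN hA hC hRt hPt L M _ _ hL hLM hLe hMe
  dsimp only
  have hK₀ : K₀ ≤ K := le_trans (le_max_left _ _) hK
  have hK1 : 1 ≤ K := le_trans ((le_max_right _ _).trans (le_max_right _ _)) hK
  have hKC : 2 * C / η ≤ K := le_trans ((le_max_left _ _).trans (le_max_right _ _)) hK
  have hKpos : 0 < K := by linarith
  have hFE' := hFE K hK₀ c hU1 hN hA hC hRt hPt L M hL hLM hLe hMe
  dsimp only at hFE'
  have hRf := timeReflection_functional_of_table 2 c hRt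
  have hJ := birEven_jensenDeficitBound c K (η * K) (mul_pos hη hKpos) L M hRf hMe
  dsimp only at hJ
  obtain ⟨hZre, -, hZhre, -, hbound⟩ := hJ
  refine ⟨fun h0 => ?_, ?_⟩
  · rw [h0] at hZre
    simp at hZre
  · have hlog := (Real.log_le_iff_le_exp (div_pos hZhre hZre)).2 ((div_le_iff₀ hZre).2 hFE')
    have h1 : Real.log _ / (η * K) ≤ C / (η * K) := div_le_div_of_nonneg_right hlog (by positivity)
    have h2 : C / (η * K) ≤ 1 / 2 := by
      rw [div_le_iff₀ (by positivity)]
      rw [div_le_iff₀ hη] at hKC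
      nlinarith
    linarith

end Summit.HubbardSuperconductivity.HubbardSuperconductivity.Theorems

end
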